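import Mathlib
import Summits.Ventures.HodgeRepro.Tier4.Common.LocalCoordinatesConj
import Summits.Ventures.HodgeRepro.Tier4.Line4.D3Coeff
import Summits.Ventures.HodgeRepro.Tier4.Line4.D3CoeffConj
import Summits.Ventures.HodgeRepro.Tier4.Line4.D3CoeffDecay

/-!
# Tier4/Line4/D3CoeffDelta — the `(0, 3)` BRANCH of the weight-3 coefficient: `D3coeffD g := (δ(g))⁻¹ ^ 3` on the
`(1,1)` coordinate, with the same kernel properties, and its `T′`-adapted form `D3coeff''` on the seesaw plane

Blind re-derivation cell `pub-hodge-repro`, Tier 4 (README §9–§10), seat t4-L1-p5 (prover, gen 4; plan-4 g4's answer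
(c) S15084 «the `(0, 3)` companion first»; cut C-L4-D3COEFF, lead (R-8) S14747; paper proofs/t4/L4/D3COEFF-t4-L1-p5.md
§2).  Target tree path `lean/Summits/Ventures/HodgeRepro/Tier4/Line4/D3CoeffDelta.lean`.  On typer-2's
`Common/LocalCoordinates(Conj)` and `LocalUnitary`, and the seat's `D3Coeff` (p699431), `D3CoeffConj` (p700675),
`D3CoeffDecay` (p701467: the `U(1,1)` identity `‖δ‖² = ‖α‖²`); no printed input.

THE OBJECT.  The `(1,1)` coordinate `δ(g) = locEntry q a b ε w g 1 1` of the `w`-block is the weight on the SECOND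
line of the torus (`locEntry_diag_eq_weightAt`), and on `U(1,1)` `|δ| = |α| ≥ 1` (`normSq_locEntry_eq`).  The
coefficient **`D3coeffD g := δ(g)⁻¹ ^ 3`** is the `(0, 3)` twin of `D3coeff = α⁻¹ ^ 3`: the lowest-weight coefficient
of the weight-3 discrete series of the OTHER orientation (`u₂^{−3}` in place of `u₁^{−3}`), the `_he' = (0, 3)` branch
of L4-MATH §15.1.

WHAT IS PROVED (kernel, no print) — the exact twins of `D3Coeff` / `D3CoeffUnitary` / `D3CoeffConj`:
* `locEntry_mul_one_one_of_mem_torusT` / `locEntry_one_one_mul_of_mem_torusT` — `δ(g κ) = δ(g) u₂(κ)`,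
  `δ(κ g) = u₂(κ) δ(g)` for `κ ∈ T(𝔸)`; `D3coeffD_one`, `D3coeffD_mul_torus`, `D3coeffD_torus_mul` (weight
  `(0, −3)` on both sides);
* `one_le_norm_locEntry_one_one`, `locEntry_one_one_ne_zero`, `continuous_D3coeffD`, `norm_D3coeffD_le_one`,
  `locEntry_inv_one_one` (`δ(g⁻¹) = conj δ(g)`), `D3coeffD_inv`;
* seesaw plane: `D3coeff'' x := D3coeffD … (conjTo x) = (locEntry' x 1 1)⁻¹ ^ 3`, `D3coeff''_one`,
  `continuous_D3coeff''`, `norm_D3coeff''_le_one`, `D3coeff''_inv`, `D3coeff''_torus'_mul`, `D3coeff''_mul_torus'`,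
  **`cj_D3coeff''_inv_mul`** = the `equiv` field of `IsArchCoeff` at `w` with `(eP′ w, eM′ w) = (0, 3)`, and
  `D3coeff''_mul_of_mem_localTorusAt'_ne` (the other places act trivially).

Nothing here says anything about the status of the Hodge conjecture for CM abelian varieties, which is NOT proved
(HC_CM is NOT proved by anyone in this repository).
-/

set_option autoImplicit false

noncomputable section

namespace Summit.Ventures.HodgeRepro.Tier4.Line4

open Summit.Ventures.HodgeRepro.Tier4.Common Summit.Ventures.HodgeRepro.Tier4.Line1 NumberField Matrix

open scoped ComplexConjugate

section D3Delta

variable {k : Type} [Field k] [NumberField k] (q : QuadData k) (a b ε : k) (w : InfinitePlace k)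

/-- **the `(0, 3)` coefficient at `w`**: `δ(g)⁻¹ ^ 3`, `δ(g) = locEntry q a b ε w g 1 1`. -/
def D3coeffD (g : GA (PlaneData.ofLinesRow q a b ε)) : ℂ := (locEntry q a b ε w g 1 1)⁻¹ ^ 3

/-- `D3coeffD 1 = 1`. -/
theorem D3coeffD_one : D3coeffD q a b ε w 1 = 1 := by
  have h : locEntry q a b ε w 1 1 1 = 1 := by
    rw [← locMat_apply, locMat_one]
    simp
  simp [D3coeffD, h]

/-- **`δ(g κ) = δ(g) · u₂(κ)`** for a torus element `κ`, `u₂(κ) = weightAt … 1 κ`. -/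
theorem locEntry_mul_one_one_of_mem_torusT (hw : w.IsReal) (hcm : IsCMAt q w) (ha : a ≠ 0) (hb : b ≠ 0)
    (hε : ε ≠ 0) (g κ : GA (PlaneData.ofLinesRow q a b ε)) (hκ : κ ∈ torusT (PlaneData.ofLinesRow q a b ε)) :
    locEntry q a b ε w (g * κ) 1 1 =
      locEntry q a b ε w g 1 1 * weightAt (PlaneData.ofLinesRow q a b ε) q w 1 κ := by
  have hmul := congrFun (congrFun (locMat_mul q a b ε w hw hcm g κ) 1) 1
  rw [locMat_apply, Matrix.mul_apply, Fin.sum_univ_two, locMat_apply, locMat_apply, locMat_apply, locMat_apply,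
    (locEntry_off_diag_of_mem_torusT q a b ε w ha hb hε κ hκ).1, mul_zero, zero_add] at hmul
  exact hmul

/-- **`δ(κ g) = u₂(κ) · δ(g)`** for a torus element `κ`. -/
theorem locEntry_one_one_mul_of_mem_torusT (hw : w.IsReal) (hcm : IsCMAt q w) (ha : a ≠ 0) (hb : b ≠ 0)
    (hε : ε ≠ 0) (g κ : GA (PlaneData.ofLinesRow q a b ε)) (hκ : κ ∈ torusT (PlaneData.ofLinesRow q a b ε)) :
    locEntry q a b ε w (κ * g) 1 1 =
      weightAt (PlaneData.ofLinesRow q a b ε) q w 1 κ * locEntry q a b ε w g 1 1 := by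
  have hmul := congrFun (congrFun (locMat_mul q a b ε w hw hcm κ g) 1) 1
  rw [locMat_apply, Matrix.mul_apply, Fin.sum_univ_two, locMat_apply, locMat_apply, locMat_apply, locMat_apply,
    (locEntry_off_diag_of_mem_torusT q a b ε w ha hb hε κ hκ).2, zero_mul, zero_add] at hmul
  exact hmul

/-- **the equivariance law (right)**: `D3coeffD (g κ) = u₂(κ)⁻¹ ^ 3 · D3coeffD g`. -/
theorem D3coeffD_mul_torus (hw : w.IsReal) (hcm : IsCMAt q w) (ha : a ≠ 0) (hb : b ≠ 0) (hε : ε ≠ 0)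
    (g κ : GA (PlaneData.ofLinesRow q a b ε)) (hκ : κ ∈ torusT (PlaneData.ofLinesRow q a b ε)) :
    D3coeffD q a b ε w (g * κ) =
      (weightAt (PlaneData.ofLinesRow q a b ε) q w 1 κ)⁻¹ ^ 3 * D3coeffD q a b ε w g := by
  unfold D3coeffD
  rw [locEntry_mul_one_one_of_mem_torusT q a b ε w hw hcm ha hb hε g κ hκ, mul_inv, mul_pow, mul_comm]

/-- **the equivariance law (left)**: `D3coeffD (κ g) = u₂(κ)⁻¹ ^ 3 · D3coeffD g`. -/
theorem D3coeffD_torus_mul (hw : w.IsReal) (hcm : IsCMAt q w) (ha : a ≠ 0) (hb : b ≠ 0) (hε : ε ≠ 0)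
    (g κ : GA (PlaneData.ofLinesRow q a b ε)) (hκ : κ ∈ torusT (PlaneData.ofLinesRow q a b ε)) :
    D3coeffD q a b ε w (κ * g) =
      (weightAt (PlaneData.ofLinesRow q a b ε) q w 1 κ)⁻¹ ^ 3 * D3coeffD q a b ε w g := by
  unfold D3coeffD
  rw [locEntry_one_one_mul_of_mem_torusT q a b ε w hw hcm ha hb hε g κ hκ, mul_inv, mul_pow]

/-- **`|δ| ≥ 1` on `U(1,1)`** (`‖δ‖² = ‖α‖²` and `|α| ≥ 1`). -/
theorem one_le_norm_locEntry_one_one (hw : w.IsReal) (hcm : IsCMAt q w)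
    (ha : 0 < (adToC w (algebraMap k (Ad k) a)).re) (hb : (adToC w (algebraMap k (Ad k) (ε * b))).re < 0)
    (g : GA (PlaneData.ofLinesRow q a b ε)) : 1 ≤ ‖locEntry q a b ε w g 1 1‖ := by
  have hD := (normSq_locEntry_eq q a b ε w hw hcm ha hb g).2.2
  have hα := one_le_norm_locEntry_zero_zero q a b ε w hw hcm (disc_ne_zero_of_isCMAt q w hw hcm) ha hb g
  rw [Complex.normSq_eq_norm_sq, Complex.normSq_eq_norm_sq] at hD
  nlinarith [norm_nonneg (locEntry q a b ε w g 1 1), norm_nonneg (locEntry q a b ε w g 0 0)]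

/-- `δ ≠ 0` on `U(1,1)`. -/
theorem locEntry_one_one_ne_zero (hw : w.IsReal) (hcm : IsCMAt q w)
    (ha : 0 < (adToC w (algebraMap k (Ad k) a)).re) (hb : (adToC w (algebraMap k (Ad k) (ε * b))).re < 0)
    (g : GA (PlaneData.ofLinesRow q a b ε)) : locEntry q a b ε w g 1 1 ≠ 0 := by
  intro h0
  have h := one_le_norm_locEntry_one_one q a b ε w hw hcm ha hb g
  rw [h0, norm_zero] at h
  exact absurd h (by norm_num)

/-- the coefficient is continuous on `U(1,1)`. -/
theorem continuous_D3coeffD (hw : w.IsReal) (hcm : IsCMAt q w)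
    (ha : 0 < (adToC w (algebraMap k (Ad k) a)).re) (hb : (adToC w (algebraMap k (Ad k) (ε * b))).re < 0) :
    Continuous (D3coeffD q a b ε w) :=
  ((continuous_locEntry q a b ε w 1 1).inv₀ fun g => locEntry_one_one_ne_zero q a b ε w hw hcm ha hb g).pow 3

/-- the coefficient is bounded by `1`. -/
theorem norm_D3coeffD_le_one (hw : w.IsReal) (hcm : IsCMAt q w)
    (ha : 0 < (adToC w (algebraMap k (Ad k) a)).re) (hb : (adToC w (algebraMap k (Ad k) (ε * b))).re < 0)
    (g : GA (PlaneData.ofLinesRow q a b ε)) : ‖D3coeffD q a b ε w g‖ ≤ 1 := by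
  unfold D3coeffD
  rw [norm_pow, norm_inv]
  exact pow_le_one₀ (inv_nonneg.2 (norm_nonneg _))
    (inv_le_one_of_one_le₀ (one_le_norm_locEntry_one_one q a b ε w hw hcm ha hb g))

/-- **`δ(g⁻¹) = conj δ(g)`** (the `(1,1)` entry of `locMat_inv_mul_J`; needs `(εb)_w ≠ 0`). -/
theorem locEntry_inv_one_one (hw : w.IsReal) (hcm : IsCMAt q w)
    (hb : adToC w (algebraMap k (Ad k) (ε * b)) ≠ 0) (g : GA (PlaneData.ofLinesRow q a b ε)) :
    locEntry q a b ε w g⁻¹ 1 1 = conj (locEntry q a b ε w g 1 1) := by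
  have h := congrFun (congrFun (locMat_inv_mul_J q a b ε w hw hcm (disc_ne_zero_of_isCMAt q w hw hcm) g) 1) 1
  simp [Jdiag, Matrix.mul_apply, locMat_apply, Matrix.diagonal, Matrix.conjTranspose_apply] at h
  have hb' : adToC w (algebraMap k (Ad k) ε) * adToC w (algebraMap k (Ad k) b) ≠ 0 := by
    rw [← map_mul, ← map_mul]
    exact hb
  exact mul_right_cancel₀ hb' (by linear_combination h)

/-- the coefficient of the inverse is the conjugate. -/
theorem D3coeffD_inv (hw : w.IsReal) (hcm : IsCMAt q w)
    (hb : adToC w (algebraMap k (Ad k) (ε * b)) ≠ 0) (g : GA (PlaneData.ofLinesRow q a b ε)) :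
    D3coeffD q a b ε w g⁻¹ = conj (D3coeffD q a b ε w g) := by
  unfold D3coeffD
  rw [locEntry_inv_one_one q a b ε w hw hcm hb g, map_pow, map_inv₀]

end D3Delta

section D3DeltaConj

variable {k : Type} [Field k] [NumberField k] (q : QuadData k) (a : Fin 4 → k)
  (g g' : Matrix (Fin 4) (Fin 4) k) (hgg' : g * g' = 1) (hg'g : g' * g = 1)
  (hgΩ : g * (PlaneData.mixedRow q (a 0) (a 2)).Ω = (PlaneData.mixedRow q (a 0) (a 2)).Ω * g)
  (lam : k) (hlam : lam ≠ 0)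
  (hiso : g * (PlaneData.mixedRow q (a 1) (a 3)).B * gᵀ = lam • (PlaneData.mixedRow q (a 0) (a 2)).B)
  (w : InfinitePlace k)

/-- **the `T′`-adapted `(0, 3)` coefficient of the seesaw plane at `w`**: `D3coeffD` of the second row plane at the
conjugate `g′ x g` — `(locEntry' x 1 1)⁻¹ ^ 3`. -/
def D3coeff'' (x : GA ((PlaneData.mixedRow q (a 0) (a 2)).withTransportedTorus g g' hgg' hg'g hgΩ)) : ℂ :=
  D3coeffD q (a 1) (a 3) (-1) w (conjTo q a g g' hgg' hg'g hgΩ lam hiso x)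

/-- `D3coeff''` in the `T′`-adapted coordinates (`rfl`). -/
theorem D3coeff''_eq (x : GA ((PlaneData.mixedRow q (a 0) (a 2)).withTransportedTorus g g' hgg' hg'g hgΩ)) :
    D3coeff'' q a g g' hgg' hg'g hgΩ lam hiso w x =
      (locEntry' q a g g' hgg' hg'g hgΩ lam hiso w x 1 1)⁻¹ ^ 3 := rfl

/-- `D3coeff'' 1 = 1`. -/
theorem D3coeff''_one : D3coeff'' q a g g' hgg' hg'g hgΩ lam hiso w 1 = 1 := by
  unfold D3coeff''
  rw [conjTo_one]
  exact D3coeffD_one q (a 1) (a 3) (-1) w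

/-- `D3coeff''` is continuous (`U(1,1)` signs at `w`). -/
theorem continuous_D3coeff'' (hw : w.IsReal) (hcm : IsCMAt q w)
    (ha1 : 0 < (adToC w (algebraMap k (Ad k) (a 1))).re) (ha3 : (adToC w (algebraMap k (Ad k) (-1 * a 3))).re < 0) :
    Continuous (D3coeff'' q a g g' hgg' hg'g hgΩ lam hiso w) :=
  (continuous_D3coeffD q (a 1) (a 3) (-1) w hw hcm ha1 ha3).comp (continuous_conjTo q a g g' hgg' hg'g hgΩ lam hiso)

/-- `‖D3coeff''‖ ≤ 1`. -/
theorem norm_D3coeff''_le_one (hw : w.IsReal) (hcm : IsCMAt q w)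
    (ha1 : 0 < (adToC w (algebraMap k (Ad k) (a 1))).re) (ha3 : (adToC w (algebraMap k (Ad k) (-1 * a 3))).re < 0)
    (x : GA ((PlaneData.mixedRow q (a 0) (a 2)).withTransportedTorus g g' hgg' hg'g hgΩ)) :
    ‖D3coeff'' q a g g' hgg' hg'g hgΩ lam hiso w x‖ ≤ 1 :=
  norm_D3coeffD_le_one q (a 1) (a 3) (-1) w hw hcm ha1 ha3 _

/-- `D3coeff'' x⁻¹ = conj (D3coeff'' x)`. -/
theorem D3coeff''_inv (hw : w.IsReal) (hcm : IsCMAt q w) (ha3 : adToC w (algebraMap k (Ad k) (-1 * a 3)) ≠ 0)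
    (x : GA ((PlaneData.mixedRow q (a 0) (a 2)).withTransportedTorus g g' hgg' hg'g hgΩ)) :
    D3coeff'' q a g g' hgg' hg'g hgΩ lam hiso w x⁻¹ = conj (D3coeff'' q a g g' hgg' hg'g hgΩ lam hiso w x) := by
  have hinv : conjTo q a g g' hgg' hg'g hgΩ lam hiso x⁻¹ = (conjTo q a g g' hgg' hg'g hgΩ lam hiso x)⁻¹ :=
    map_inv (conjToHom q a g g' hgg' hg'g hgΩ lam hiso) x
  unfold D3coeff''
  rw [hinv]
  exact D3coeffD_inv q (a 1) (a 3) (-1) w hw hcm ha3 _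

include hlam in
/-- **the `T′`-law (left)**: `D3coeff'' (κ x) = (weightAt' … 1 κ)⁻¹ ^ 3 · D3coeff'' x` for `κ ∈ T′(𝔸)`. -/
theorem D3coeff''_torus'_mul (hw : w.IsReal) (hcm : IsCMAt q w) (ha1 : a 1 ≠ 0) (ha3 : a 3 ≠ 0)
    (x κ : GA ((PlaneData.mixedRow q (a 0) (a 2)).withTransportedTorus g g' hgg' hg'g hgΩ))
    (hκ : κ ∈ torusT' ((PlaneData.mixedRow q (a 0) (a 2)).withTransportedTorus g g' hgg' hg'g hgΩ)) :
    D3coeff'' q a g g' hgg' hg'g hgΩ lam hiso w (κ * x) =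
      (weightAt' ((PlaneData.mixedRow q (a 0) (a 2)).withTransportedTorus g g' hgg' hg'g hgΩ) q w g g' 1 κ)⁻¹ ^ 3 *
        D3coeff'' q a g g' hgg' hg'g hgΩ lam hiso w x := by
  rw [weightAt'_eq_weightAt_conjTo q a g g' hgg' hg'g hgΩ lam hiso]
  unfold D3coeff''
  rw [conjTo_mul]
  exact D3coeffD_torus_mul q (a 1) (a 3) (-1) w hw hcm ha1 ha3 (by norm_num) _ _
    (conjTo_mem_torusT_of_mem_torusT' q a g g' hgg' hg'g hgΩ lam hlam hiso hκ)

include hlam in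
/-- **the `T′`-law (right)**: `D3coeff'' (x κ) = (weightAt' … 1 κ)⁻¹ ^ 3 · D3coeff'' x` for `κ ∈ T′(𝔸)`. -/
theorem D3coeff''_mul_torus' (hw : w.IsReal) (hcm : IsCMAt q w) (ha1 : a 1 ≠ 0) (ha3 : a 3 ≠ 0)
    (x κ : GA ((PlaneData.mixedRow q (a 0) (a 2)).withTransportedTorus g g' hgg' hg'g hgΩ))
    (hκ : κ ∈ torusT' ((PlaneData.mixedRow q (a 0) (a 2)).withTransportedTorus g g' hgg' hg'g hgΩ)) :
    D3coeff'' q a g g' hgg' hg'g hgΩ lam hiso w (x * κ) =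
      (weightAt' ((PlaneData.mixedRow q (a 0) (a 2)).withTransportedTorus g g' hgg' hg'g hgΩ) q w g g' 1 κ)⁻¹ ^ 3 *
        D3coeff'' q a g g' hgg' hg'g hgΩ lam hiso w x := by
  rw [weightAt'_eq_weightAt_conjTo q a g g' hgg' hg'g hgΩ lam hiso]
  unfold D3coeff''
  rw [conjTo_mul]
  exact D3coeffD_mul_torus q (a 1) (a 3) (-1) w hw hcm ha1 ha3 (by norm_num) _ _
    (conjTo_mem_torusT_of_mem_torusT' q a g g' hgg' hg'g hgΩ lam hlam hiso hκ)

include hlam in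
/-- **THE `equiv` FIELD OF `IsArchCoeff` AT `w` FOR THE `(0, 3)` BRANCH**: for `κ` in the local torus `T′_w`,
`cj (D3coeff'') (κ⁻¹ y) = (weightAt' … 0 κ) ^ (−0) · (weightAt' … 1 κ) ^ (−3) · cj (D3coeff'') y` —
`(eP′ w, eM′ w) = (0, 3)`. -/
theorem cj_D3coeff''_inv_mul (hw : w.IsReal) (hcm : IsCMAt q w) (ha1 : a 1 ≠ 0) (ha3 : a 3 ≠ 0)
    {κ : GA ((PlaneData.mixedRow q (a 0) (a 2)).withTransportedTorus g g' hgg' hg'g hgΩ)}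
    (hκ : κ ∈ localTorusAt' ((PlaneData.mixedRow q (a 0) (a 2)).withTransportedTorus g g' hgg' hg'g hgΩ) w)
    (y : GA ((PlaneData.mixedRow q (a 0) (a 2)).withTransportedTorus g g' hgg' hg'g hgΩ)) :
    RTF.cj (D3coeff'' q a g g' hgg' hg'g hgΩ lam hiso w) (κ⁻¹ * y) =
      weightAt' ((PlaneData.mixedRow q (a 0) (a 2)).withTransportedTorus g g' hgg' hg'g hgΩ) q w g g' 0 κ ^
          (-(0 : ℤ)) *
        weightAt' ((PlaneData.mixedRow q (a 0) (a 2)).withTransportedTorus g g' hgg' hg'g hgΩ) q w g g' 1 κ ^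
          (-(3 : ℤ)) *
        RTF.cj (D3coeff'' q a g g' hgg' hg'g hgΩ lam hiso w) y := by
  have hκT : κ ∈ torusT' ((PlaneData.mixedRow q (a 0) (a 2)).withTransportedTorus g g' hgg' hg'g hgΩ) := hκ.1
  have hκT' : κ⁻¹ ∈ torusT' ((PlaneData.mixedRow q (a 0) (a 2)).withTransportedTorus g g' hgg' hg'g hgΩ) :=
    (torusT' _).inv_mem hκT
  unfold RTF.cj
  rw [D3coeff''_torus'_mul q a g g' hgg' hg'g hgΩ lam hlam hiso w hw hcm ha1 ha3 y κ⁻¹ hκT',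
    weightAt'_inv_of_mem_torusT' q a g g' hgg' hg'g hgΩ lam hlam hiso w hw hcm ha1 ha3 1 hκT, inv_inv, map_mul,
    map_pow, conj_weightAt'_of_mem_torusT' q a g g' hgg' hg'g hgΩ lam hlam hiso w hw hcm ha1 ha3 1 hκT,
    neg_zero, zpow_zero, one_mul, _root_.zpow_neg, zpow_ofNat, inv_pow]

include hlam in
/-- **the other places act trivially**: for `κ` in the local torus `T′_{w′}` at a place `w′ ≠ w`,
`D3coeff'' (κ x) = D3coeff'' x`. -/
theorem D3coeff''_mul_of_mem_localTorusAt'_ne (hw : w.IsReal) (hcm : IsCMAt q w) {w' : InfinitePlace k} (hne : w' ≠ w)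
    {κ : GA ((PlaneData.mixedRow q (a 0) (a 2)).withTransportedTorus g g' hgg' hg'g hgΩ)}
    (hκ : κ ∈ localTorusAt' ((PlaneData.mixedRow q (a 0) (a 2)).withTransportedTorus g g' hgg' hg'g hgΩ) w')
    (x : GA ((PlaneData.mixedRow q (a 0) (a 2)).withTransportedTorus g g' hgg' hg'g hgΩ)) :
    D3coeff'' q a g g' hgg' hg'g hgΩ lam hiso w (κ * x) = D3coeff'' q a g g' hgg' hg'g hgΩ lam hiso w x := by
  have hat : IsAtPlace (PlaneData.ofLinesRow q (a 1) (a 3) (-1)) w' (conjTo q a g g' hgg' hg'g hgΩ lam hiso κ) :=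
    (conjTo_mem_localTorusAt_of_mem_localTorusAt' q a g g' hgg' hg'g hgΩ lam hlam hiso w' hκ).2
  have hcomp : GA.infiniteComponent (PlaneData.ofLinesRow q (a 1) (a 3) (-1)) w
      (conjTo q a g g' hgg' hg'g hgΩ lam hiso κ) = 1 := hat.2 w hne.symm
  have hone : locMat q (a 1) (a 3) (-1) w (conjTo q a g g' hgg' hg'g hgΩ lam hiso κ) = 1 := by
    funext I J
    rw [locMat_apply, locEntry, entryAt, entryAt, hcomp]
    fin_cases I <;> fin_cases J <;> simp [lineBase, lineOmega]
  unfold D3coeff''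
  rw [conjTo_mul]
  unfold D3coeffD
  have hmul := congrFun (congrFun (locMat_mul q (a 1) (a 3) (-1) w hw hcm
    (conjTo q a g g' hgg' hg'g hgΩ lam hiso κ) (conjTo q a g g' hgg' hg'g hgΩ lam hiso x)) 1) 1
  rw [hone, one_mul, locMat_apply, locMat_apply] at hmul
  rw [hmul]

end D3DeltaConj

end Summit.Ventures.HodgeRepro.Tier4.Line4

end
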